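import Mathlib
import Literature.NumberTheory.LFunctions.Zhang2022.TypedSection12B
import Literature.NumberTheory.LFunctions.Zhang2022.AppendixAEulerProductU004
import HarnessLib

/-!
# Zhang (2022) §12 p. 69, step u024: the `g`-weighted series IS the Perron integral on `(1)`

Topic `Literature/NumberTheory/LFunctions/Zhang2022` (Landau–Siegel audit tree; verdict-neutral).
Y. Zhang, *Discrete mean estimates and the Landau–Siegel zero*, arXiv:2211.02515v1 (2022)
[Zhang2022LandauSiegel], §12 proof of Lemma 12.2, p. 69, tex L3528 — **an unrefereed manuscript
under adjudication; nothing here asserts or denies its Theorems 1–2.**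

The typed node `Typed.Sec12B.U024` (DAG node `Z22:§12.u024`, lane ZHANG-L helper H1 of WP12-PLAN
under leaf h1212) reads "Suppose `dr ≤ P″₁/T`. By (4) and (4) [sic], for `|w| = α` we have
`Σ_{P″₁/dr<l<P″₂/dr} χ(l)ξ_j(l;d,r)/l^{1−β₆+w} = Σ_l χ(l)ξ_j(l;d,r)/l^{1−β₆+w}{g(P″₂/(drl)) −
g(P″₁/(drl))} + O(𝓛⁻¹⁵) = (2πi)⁻¹∫_{(1)}(Σ_l χ(l)ξ_j(l;d,r)/l^{1−β₆+w+s})((P″₂/dr)^s −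
(P″₁/dr)^s)ω₁(s)ds/s + O(𝓛⁻¹⁵)`" — two `O(𝓛⁻¹⁵)`-approximations of the sharp window sum
`innerSum` by the `g`-weighted series `gSeries` and by the Perron integral `lineInt024`.

THIS FILE proves that the SECOND of the two printed equalities is an IDENTITY (error `0`):

* `gSeries_eq_lineInt024` — for `D ≥ 3`, `d, r ≥ 1` and `Re w > −1`,
  `gSeries c′ χ j d r w = lineInt024 c′ χ j d r w`. It is the tree's generic `g`-Mellin identity
  `GaussWeight.integral_LSeries_mul_kernel` (`(1/2π)∫_ℝ L(a, s+1+it) X^{1+it}ω₁(1+it)(1+it)⁻¹ dt =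
  Σₙ aₙ n^{−s} g(X/n)`, Section4GaussianWeight) at `a(n) = χ(n)ξ₀ⱼ(n;d,r)`, `s = 1 − β₆ + w`, run
  once for the DIFFERENCE kernel `K_{X₂} − K_{X₁}` (`X₂ = P″₂/dr`, `X₁ = P″₁/dr`) so that no
  summability of `Σ aₙ n^{−s} g(Xᵢ/n)` at `Re s ≤ 1` is needed: the interchange of `Σ` and `∫` uses
  only the absolute convergence of the `ξ₀ⱼ`-series at `Re(s+1) = 2 + Re w > 1`
  (`Lemma83.lseriesSummable_chi_mul_xiZero`, AppendixAEulerProductU004) and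
  `Σₙ ∫|aₙn^{−s}(K_{X₂/n} − K_{X₁/n})| ≤ (X₂ + X₁)·M(Λ,1)·Σ|aₙ|n^{−(σ+1)} < ∞`;
  the series `Σ_l χ(l)ξ₀ⱼ(l;d,r)l^{−s}` is the tree's `Skeleton.xiSeries` (`xiSeries_eq_tsum_term`).
* `norm_innerSum_sub_lineInt024_eq` — hence `‖innerSum − lineInt024‖ = ‖innerSum − gSeries‖`:
  the node `U024` is EQUIVALENT to its first conjunct (`u024_of_first`), the window estimate
  `innerSum − gSeries = O(𝓛⁻¹⁵)` ("by (4.2)–(4.3)"), which is proved elsewhere.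

0 new definitions; standard axioms.

## References

* Y. Zhang, arXiv:2211.02515v1 (2022), §12 p. 69 (proof of Lemma 12.2, tex L3528); §4 (4.1)–(4.3)
  p. 8. [cite: Zhang2022LandauSiegel, §12 p. 69; §4 (4.1)]
* H. L. Montgomery, R. C. Vaughan, *Multiplicative Number Theory I* (CUP 2007), §5.1 (5.15)–(5.16)
  (weights as inverse Mellin transforms of kernels). [cite: MontgomeryVaughan2007, §5.1]
-/

noncomputable section

open Complex Real MeasureTheory

namespace Literature.NumberTheory.LFunctions.Zhang2022.Typed.Sec12B

open Literature.NumberTheory.LFunctions.Zhang2022.Skeleton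
open Literature.NumberTheory.LFunctions.Zhang2022.GaussWeight
open LSeries (term)

variable (c' : ℝ) {D : ℕ} (χ : DirichletCharacter ℂ D)

/-! ### The difference kernel `K_{X₂} − K_{X₁}` against an `L`-series -/

section DifferenceKernel

variable {Λ c : ℝ}

/-- **The `g`-Mellin identity for a difference of two cut-off points.** If `Σₙ aₙ n^{−(s+c)}`
converges absolutely (`Λ, c, X₁, X₂ > 0`), then
`(1/2π)∫_ℝ L(a, s+c+it)·(K_{X₂}(t) − K_{X₁}(t)) dt = Σₙ aₙ n^{−s}·(g(X₂/n) − g(X₁/n))`,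
`K_X(t) = X^{c+it}ω₁(c+it)(c+it)⁻¹` (`GaussWeight.kernel`), `g = GaussWeight.gWeight Λ`. Same proof
as the tree's `GaussWeight.integral_LSeries_mul_kernel` (termwise `integral_term_mul_kernel`,
interchange by `integral_tsum_of_summable_integral_norm`); stated for the difference so that the
right-hand side need not be split into two (possibly only conditionally convergent) series.
[cite: Zhang2022LandauSiegel, §4 (4.1); §12 p. 69] -/
theorem integral_LSeries_mul_kernel_sub (hΛ : 0 < Λ) (hc : 0 < c) {X₁ X₂ : ℝ} (hX₁ : 0 < X₁)
    (hX₂ : 0 < X₂) {a : ℕ → ℂ} {s : ℂ} (hs : LSeriesSummable a (s + c)) :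
    (1 / (2 * π) : ℂ) * ∫ t : ℝ, LSeries a (s + (c + t * I)) * (kernel Λ c X₂ t - kernel Λ c X₁ t)
      = ∑' n : ℕ, term a s n * ((gWeight Λ (X₂ / n) : ℂ) - (gWeight Λ (X₁ / n) : ℂ)) := by
  have hπ : (π : ℂ) ≠ 0 := ofReal_ne_zero.mpr Real.pi_ne_zero
  -- pointwise: the integrand is the series of the termwise products
  have hsum_eq : (fun t : ℝ => LSeries a (s + (c + t * I)) * (kernel Λ c X₂ t - kernel Λ c X₁ t))
      = fun t => ∑' n : ℕ, (term a s n * kernel Λ c (X₂ / n) t - term a s n * kernel Λ c (X₁ / n) t) := by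
    funext t
    rw [LSeries, ← tsum_mul_right]
    refine tsum_congr (fun n => ?_)
    rw [mul_sub, term_mul_kernel Λ c hX₂ a s n t, term_mul_kernel Λ c hX₁ a s n t]
  -- each termwise product is integrable
  have hint : ∀ n : ℕ, Integrable
      (fun t : ℝ => term a s n * kernel Λ c (X₂ / n) t - term a s n * kernel Λ c (X₁ / n) t) :=
    fun n => (integrable_term_mul_kernel hΛ hc hX₂ a s n).sub (integrable_term_mul_kernel hΛ hc hX₁ a s n)
  -- the sum of the `L¹` norms is finite
  have hG_sum : Summable (fun n : ℕ => ∫ t : ℝ,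
      ‖term a s n * kernel Λ c (X₂ / n) t - term a s n * kernel Λ c (X₁ / n) t‖) := by
    have hmaj : Summable (fun n : ℕ =>
        ‖term a (s + c) n‖ * (X₂ ^ c * lineConst Λ c) + ‖term a (s + c) n‖ * (X₁ ^ c * lineConst Λ c)) :=
      ((summable_norm_iff.mpr hs).mul_right _).add ((summable_norm_iff.mpr hs).mul_right _)
    refine Summable.of_nonneg_of_le (fun n => integral_nonneg (fun t => norm_nonneg _)) (fun n => ?_) hmaj
    rw [← integral_norm_term_mul_kernel Λ c hX₂ a s n, ← integral_norm_term_mul_kernel Λ c hX₁ a s n,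
      ← integral_add (integrable_term_mul_kernel hΛ hc hX₂ a s n).norm
        (integrable_term_mul_kernel hΛ hc hX₁ a s n).norm]
    exact integral_mono (hint n).norm
      ((integrable_term_mul_kernel hΛ hc hX₂ a s n).norm.add
        (integrable_term_mul_kernel hΛ hc hX₁ a s n).norm) (fun t => norm_sub_le _ _)
  rw [hsum_eq, ← integral_tsum_of_summable_integral_norm hint hG_sum]
  have hterm : ∀ n : ℕ, ∫ t : ℝ, (term a s n * kernel Λ c (X₂ / n) t - term a s n * kernel Λ c (X₁ / n) t)
      = 2 * π * (term a s n * ((gWeight Λ (X₂ / n) : ℂ) - (gWeight Λ (X₁ / n) : ℂ))) := by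
    intro n
    rw [integral_sub (integrable_term_mul_kernel hΛ hc hX₂ a s n) (integrable_term_mul_kernel hΛ hc hX₁ a s n),
      integral_term_mul_kernel hΛ hc hX₂, integral_term_mul_kernel hΛ hc hX₁]
    ring
  simp_rw [hterm]
  rw [tsum_mul_left]
  field_simp

end DifferenceKernel

/-! ### The §12 instance: `gSeries = lineInt024` -/

section U024

variable {c' χ}

/-- `𝓛³⁰ > 0` once `D ≥ 3`. [cite: Zhang2022LandauSiegel, §4 p. 8] -/
theorem ell_pow_thirty_pos (hD : 3 ≤ D) : 0 < ell D ^ 30 :=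
  pow_pos (Real.log_pos (by exact_mod_cast lt_of_lt_of_le (by norm_num) hD)) 30

/-- The `ξ₀ⱼ`-series of Lemma 8.3 is the `L`-series of `n ↦ χ(n)ξ₀ⱼ(n;d,r)`.
[cite: Zhang2022LandauSiegel, §8 Lemma 8.3 p. 46] -/
theorem xiSeries_eq_LSeries (j d r : ℕ) (s : ℂ) :
    xiSeries c' χ j d r s = LSeries (fun n => χ (n : ZMod D) * xiZero c' D j n d r) s :=
  Lemma83.xiSeries_eq_tsum_term c' χ j d r s

/-- The summand of `gSeries` is `term a s l · (g(X₂/l) − g(X₁/l))` with `a = χ·ξ₀ⱼ(·;d,r)`,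
`s = 1 − β₆ + w`, `Xᵢ = P″ᵢ/dr` (at `l = 0` both sides vanish: `ξ₀ⱼ(0;d,r) = 0`).
[cite: Zhang2022LandauSiegel, §12 p. 69] -/
theorem gSeries_summand_eq (j d r : ℕ) (w : ℂ) (l : ℕ) :
    χ (l : ZMod D) * xiZero c' D j l d r / (l : ℂ) ^ (1 - beta6 D + w) *
        ((gW D (P2pp D / ((d * r * l : ℕ) : ℝ)) - gW D (P1pp D / ((d * r * l : ℕ) : ℝ)) : ℝ) : ℂ)
      = term (fun n => χ (n : ZMod D) * xiZero c' D j n d r) (1 - beta6 D + w) l *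
          ((gWeight (ell D ^ 30) (P2pp D / ((d * r : ℕ) : ℝ) / l) : ℂ) -
            (gWeight (ell D ^ 30) (P1pp D / ((d * r : ℕ) : ℝ) / l) : ℂ)) := by
  rcases eq_or_ne l 0 with rfl | hl
  · simp [LSeries.term_zero, Lemma83.xiZero_apply_zero]
  · rw [LSeries.term_of_ne_zero hl, gW, gW, Nat.cast_mul, div_div, div_div]
    push_cast
    ring

/-- The integrand of `lineInt024` is `L(a, s+1+it)·(K_{X₂}(t) − K_{X₁}(t))` (`c = 1`, `Λ = 𝓛³⁰`).
[cite: Zhang2022LandauSiegel, §12 p. 69] -/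
theorem lineInt024_integrand_eq (j d r : ℕ) (w : ℂ) (t : ℝ) :
    xiSeries c' χ j d r (1 - beta6 D + w + (1 + t * I)) *
        (((P2pp D / ((d * r : ℕ) : ℝ) : ℝ) : ℂ) ^ ((1 : ℂ) + t * I) -
          ((P1pp D / ((d * r : ℕ) : ℝ) : ℝ) : ℂ) ^ ((1 : ℂ) + t * I)) *
        GaussWeight.omega1 (ell D ^ 30) (1 + t * I) / (1 + t * I)
      = LSeries (fun n => χ (n : ZMod D) * xiZero c' D j n d r) (1 - beta6 D + w + ((1 : ℝ) + t * I)) *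
          (kernel (ell D ^ 30) 1 (P2pp D / ((d * r : ℕ) : ℝ)) t -
            kernel (ell D ^ 30) 1 (P1pp D / ((d * r : ℕ) : ℝ)) t) := by
  rw [xiSeries_eq_LSeries, kernel, kernel]
  push_cast
  ring

/-- **`gSeries = lineInt024` (§12 p. 69, second equality of u024, with error `0`).** For `D ≥ 2`,
`d, r ≥ 1`, any `j` and any `w` with `Re w > −1` (`D ≥ 3`):
`Σ_l χ(l)ξ₀ⱼ(l;d,r)l^{−(1−β₆+w)}{g(P″₂/(drl)) − g(P″₁/(drl))} =
(2π)⁻¹∫_ℝ (Σ_l χ(l)ξ₀ⱼ(l;d,r)l^{−(1−β₆+w+1+it)})((P″₂/dr)^{1+it} − (P″₁/dr)^{1+it})ω₁(1+it)(1+it)⁻¹dt`.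
[cite: Zhang2022LandauSiegel, §12 proof of Lemma 12.2, p. 69, tex L3528] -/
theorem gSeries_eq_lineInt024 (hD : 3 ≤ D) {d r : ℕ} (hd : d ≠ 0) (hr : r ≠ 0) (j : ℕ) {w : ℂ}
    (hw : -1 < w.re) : gSeries c' χ j d r w = lineInt024 c' χ j d r w := by
  set a : ℕ → ℂ := fun n => χ (n : ZMod D) * xiZero c' D j n d r with ha
  set s : ℂ := 1 - beta6 D + w with hs_def
  have hdr : 0 < ((d * r : ℕ) : ℝ) := by
    exact_mod_cast Nat.pos_of_ne_zero (mul_ne_zero hd hr)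
  have hX₁ : 0 < P1pp D / ((d * r : ℕ) : ℝ) := div_pos (P1pp_pos hD) hdr
  have hP2 : 0 < P2pp D := by
    have hD0 : (0 : ℝ) < D := by exact_mod_cast lt_of_lt_of_le (by norm_num) hD
    have hℓ : 0 < ell D := Real.log_pos (by exact_mod_cast lt_of_lt_of_le (by norm_num) hD)
    unfold P2pp t0 bigP
    positivity
  have hX₂ : 0 < P2pp D / ((d * r : ℕ) : ℝ) := div_pos hP2 hdr
  have hΛ : 0 < ell D ^ 30 := ell_pow_thirty_pos hD
  -- absolute convergence at `s + 1`: `Re(s+1) = 2 + Re w > 1`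
  have hsum : LSeriesSummable a (s + ((1 : ℝ) : ℂ)) := by
    refine Lemma83.lseriesSummable_chi_mul_xiZero c' D j χ hd hr ?_
    have hβ : (beta6 D).re = 0 := by simp [beta6]
    simp only [hs_def, add_re, sub_re, one_re, hβ, ofReal_re]
    linarith
  have hmain := integral_LSeries_mul_kernel_sub (a := a) (s := s) hΛ one_pos hX₁ hX₂ hsum
  -- left side: `gSeries` is the series of the right-hand side of `hmain`
  have hL : gSeries c' χ j d r w = ∑' n : ℕ, term a s n *
      ((gWeight (ell D ^ 30) (P2pp D / ((d * r : ℕ) : ℝ) / n) : ℂ) -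
        (gWeight (ell D ^ 30) (P1pp D / ((d * r : ℕ) : ℝ) / n) : ℂ)) := by
    unfold gSeries
    exact tsum_congr (fun l => gSeries_summand_eq j d r w l)
  -- right side: `lineInt024` is the integral of the left-hand side of `hmain`
  have hR : lineInt024 c' χ j d r w = (1 / (2 * π) : ℂ) * ∫ t : ℝ,
      LSeries a (s + ((1 : ℝ) + t * I)) *
        (kernel (ell D ^ 30) 1 (P2pp D / ((d * r : ℕ) : ℝ)) t -
          kernel (ell D ^ 30) 1 (P1pp D / ((d * r : ℕ) : ℝ)) t) := by
    unfold lineInt024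
    rw [show (((1 / (2 * π) : ℝ)) : ℂ) = (1 / (2 * π) : ℂ) by push_cast; ring]
    congr 1
    exact integral_congr_ae (ae_of_all _ (fun t => lineInt024_integrand_eq j d r w t))
  rw [hL, hR, hmain]

/-- **`‖innerSum − lineInt024‖ = ‖innerSum − gSeries‖`**: the two error terms of u024 coincide.
[cite: Zhang2022LandauSiegel, §12 proof of Lemma 12.2, p. 69, tex L3528] -/
theorem norm_innerSum_sub_lineInt024_eq (hD : 3 ≤ D) {d r : ℕ} (hd : d ≠ 0) (hr : r ≠ 0) (j : ℕ)
    {w : ℂ} (hw : -1 < w.re) :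
    ‖innerSum c' χ j d r w - lineInt024 c' χ j d r w‖ = ‖innerSum c' χ j d r w - gSeries c' χ j d r w‖ := by
  rw [gSeries_eq_lineInt024 hD hd hr j hw]

/-- On the circle `|w| = α` one has `Re w > −1` as soon as `α < 1` (`α = π/𝓛⁹`).
[cite: Zhang2022LandauSiegel, §2 (2.10)] -/
theorem neg_one_lt_re_of_norm_eq_alpha {w : ℂ} (hα : alpha D < 1) (hw : ‖w‖ = alpha D) :
    -1 < w.re := by
  have h := Complex.abs_re_le_norm w
  rw [hw] at h
  have := neg_abs_le w.re
  linarith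

/-- `α = π/𝓛⁹ < 1` once `D ≥ 9` (`𝓛 = log D ≥ log 9 > 2`, `𝓛⁹ > π`).
[cite: Zhang2022LandauSiegel, §2 (2.10)] -/
theorem alpha_lt_one (hD : 9 ≤ D) : alpha D < 1 := by
  have hD' : (9 : ℝ) ≤ D := by exact_mod_cast hD
  have hℓ : 2 < ell D := by
    unfold ell
    have h9 : (2 : ℝ) < Real.log 9 := by
      have : Real.exp 2 < 9 := by
        have := Real.exp_one_lt_d9
        have h2 : Real.exp 2 = Real.exp 1 * Real.exp 1 := by rw [← Real.exp_add]; norm_num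
        rw [h2]; nlinarith [Real.exp_pos 1]
      exact (Real.lt_log_iff_exp_lt (by norm_num)).mpr this
    exact lt_of_lt_of_le h9 (Real.log_le_log (by norm_num) hD')
  have hP : Real.log (bigP D) = ell D ^ 9 := by rw [bigP, Real.log_exp]
  have hℓ9 : Real.pi < ell D ^ 9 := by
    have h4 : Real.pi < 4 := Real.pi_lt_four
    have : (4 : ℝ) ≤ ell D ^ 9 := by
      calc (4 : ℝ) ≤ 2 ^ 9 := by norm_num
        _ ≤ ell D ^ 9 := by gcongr
    linarith
  unfold alpha
  rw [hP, div_lt_one (lt_trans Real.pi_pos hℓ9)]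
  exact hℓ9

/-- **`U024` is its first conjunct.** If the `g`-weighted series approximates the sharp window sum
to `O(𝓛⁻¹⁵)` (the content of "by (4.2) and (4.3)"), then so does the Perron integral on `(1)`, with
the same constant, because the two are equal (`gSeries_eq_lineInt024`).
[cite: Zhang2022LandauSiegel, §12 proof of Lemma 12.2, p. 69, tex L3528] -/
theorem u024_of_first
    (h : ∃ C : ℝ, ForAllLarge fun D _ χ => AssumptionA D χ →
      ∀ j ∈ ({1, 2, 3} : Finset ℕ), ∀ d r : ℕ, 1 ≤ d → 1 ≤ r →
        ((d * r : ℕ) : ℝ) ≤ P1pp D / bigT D → ∀ w : ℂ, ‖w‖ = alpha D →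
          ‖innerSum c' χ j d r w - gSeries c' χ j d r w‖ ≤ C * (ell D ^ 15)⁻¹) :
    U024 c' := by
  obtain ⟨C, D₀, hD₀⟩ := h
  refine ⟨C, max D₀ 9, fun D _ χ hD hq hp hA j hj d r hd hr hdr w hw => ?_⟩
  have hD9 : 9 ≤ D := le_trans (le_max_right _ _) hD
  have h1 := hD₀ D χ (le_trans (le_max_left _ _) hD) hq hp hA j hj d r hd hr hdr w hw
  refine ⟨h1, ?_⟩
  rw [norm_innerSum_sub_lineInt024_eq (le_trans (by norm_num) hD9) (Nat.one_le_iff_ne_zero.mp hd)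
    (Nat.one_le_iff_ne_zero.mp hr) j (neg_one_lt_re_of_norm_eq_alpha (alpha_lt_one hD9) hw)]
  exact h1

end U024

end Literature.NumberTheory.LFunctions.Zhang2022.Typed.Sec12B

end
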